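import Summits.HodgeConjecture.HodgeConjecture.Theorems.PadicSemiregularLiftHodgeAbelianVarietiesAndreMain

/-!
# Crux `HodgeAbelianVarieties` (stmt-HodgeConjecture-1333), line `cm-pivot-andre` — STUB 1 `stub_andreSplitWeilCM` (André's decomposition with CM targets)

The registered stub `stub_andreSplitWeilCM : AndreSplitWeilCM` of `Cruxes/HodgeAbelianVarieties/Lines/cm_pivot_andre.lean`:
André 1992 — every rational `(p,p)`-class (`0 < p`) on a complex abelian variety with a CM subalgebra is a sum of
pull-backs, along homomorphisms, of rational `(p,p)` Weil eigen-classes on abelian varieties with CM subalgebras and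
Weil-type eigen-data. PROVED on the tree's real carriers by the lead's construction (`work/andre/PLAN.md`; modules
`…Andre*.lean`, assembled in `andre_main`); this file adds the degenerate case `2p > 2 dim A` (`H²ᵖ = 0`). The statement
is keyed, as for `stub_homPullback`, by a file-local notation expanding to the skeleton's definition VERBATIM.
-/

set_option linter.dupNamespace false

noncomputable section

namespace Summit.HodgeConjecture.HodgeConjecture.Theorems.HodgeAbelianVarieties.CMPivotAndre

open CategoryTheory
open Literature.AlgebraicGeometry Literature.AlgebraicGeometry.Motives Literature.AlgebraicGeometry.HodgeTheory

/-- `IsCMSub[A]` — the CM hypothesis of the item VERBATIM (as in the skeleton). Local notation only. -/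
local notation3 (prettyPrint := false) "IsCMSub[" A "]" =>
  ∃ S : Subalgebra ℚ (AbelianVariety.endAlgebra A), IsReduced ↥S ∧ (∀ x ∈ S, ∀ y ∈ S, x * y = y * x) ∧
    Module.finrank ℚ ↥S = 2 * AbelianVariety.dim A

/-- `AndreSplitWeilCM` — the registered stub signature of `Lines/cm_pivot_andre.lean`, expanding to the body of the
skeleton's `def AndreSplitWeilCM` VERBATIM. Local notation only. -/
local notation3 (prettyPrint := false) "AndreSplitWeilCM" =>
  ∀ (A : AbelianVariety ℂ), IsCMSub[A] → ∀ (p : ℕ), 0 < p →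
    ∀ c : complexBetti A.X (2 * p), IsRationalClass c → IsOfHodgeType A.dim A.X (2 * p) p p c →
      ∃ (m : ℕ) (B : Fin m → AbelianVariety ℂ) (f : ∀ i, A ⟶ B i) (ψ : ∀ i, B i ⟶ B i)
        (S : Fin m → Finset ℂ) (t : ∀ i, complexBetti (B i).X (2 * p)),
        (∀ i, IsCMSub[B i]) ∧
        (∀ i, ∀ μ ∈ S i, μ.im ≠ 0) ∧
        (∀ i, (⨆ μ ∈ S i, Module.End.eigenspace (complexBetti.map (ψ i).hom.hom.hom 1).hom μ) = ⊤) ∧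
        (∀ i, ∀ μ ∈ S i, Module.finrank ℂ
            (Module.End.eigenspace (complexBetti.map (ψ i).hom.hom.hom 1).hom μ) = 2 * p) ∧
        (∀ i, IsRationalClass (t i)) ∧
        (∀ i, IsOfHodgeType (B i).dim (B i).X (2 * p) p p (t i)) ∧
        (∀ i, t i ∈ ⨆ μ ∈ S i, pullbackEigenclasses (B i) (ψ i) (2 * p)
            (fun x y => ((x : ℂ) + (y : ℂ) * μ) ^ (2 * p))) ∧
        c = ∑ i, complexBetti.map (f i).hom.hom.hom (2 * p) (t i)

/-- **Stub 1 of line `cm-pivot-andre` — André's decomposition with CM targets** (André 1992 = Markman,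
arXiv:2509.23403, Thm. 1.4; Deligne–Milne LNM 900 endnote 18), PROVED on the tree's carriers: the main case
`2p ≤ 2 dim A` is `andre_main`; for `2p > 2 dim A`, `H²ᵖ(A(ℂ); ℂ) = ⋀²ᵖ H¹ = 0` and the empty decomposition works.
[cite: Andre1992HodgeCM, Théorème] [cite: Deligne1982HodgeCycles, §4 (4.3)–(4.4) and endnote 18] -/
theorem stub_andreSplitWeilCM : AndreSplitWeilCM := by
  intro A hCM p hp c hc hh
  by_cases hpg : 2 * p ≤ 2 * A.dim
  · exact andre_main A p hp hpg hCM c hc hh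
  · haveI : Subsingleton (complexBetti A.X (2 * p)) :=
      abelianVarietyCohomologyExteriorH1.subsingleton_of_lt abelianVarietyCohomologyExteriorH1_holds A (by omega)
    refine ⟨0, Fin.elim0, fun i => Fin.elim0 i, fun i => Fin.elim0 i, Fin.elim0, fun i => Fin.elim0 i,
      fun i => Fin.elim0 i, fun i => Fin.elim0 i, fun i => Fin.elim0 i, fun i => Fin.elim0 i, fun i => Fin.elim0 i,
      fun i => Fin.elim0 i, fun i => Fin.elim0 i, ?_⟩
    exact Subsingleton.elim _ _

end Summit.HodgeConjecture.HodgeConjecture.Theorems.HodgeAbelianVarieties.CMPivotAndre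

end
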